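import Summits.QuantumAdvantage.QuantumAdvantage.Theorems.LinnikCubicClassGroupsDegreeOnePrimesEscapeConjClassPNTPiAll
import Summits.QuantumAdvantage.QuantumAdvantage.Theorems.LinnikCubicClassGroupsDegreeOnePrimesEscapeFrobeniusClassBookkeeping
import HarnessLib

/-!
# The Chebotarev prime number theorem in the Linnik range for conjugation-invariant sets

Topic `Summits/QuantumAdvantage/QuantumAdvantage/Theorems`, cell B2b-1 (linnik-cubic), PART A (gen 14);
helper toward the crux `DegreeOnePrimesEscape` (stmt-QuantumAdvantage-11543) of route
`LinnikCubicClassGroups`.  HONEST FRAMING: the value of this file is a THEOREM (kernel-checked, GRH-free,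
Siegel-free, no hypothesis) — NOT summit progress.

**Theorem** (`conjInvariant_PNT_pi`).  For `n > 1` and `0 < ε ≤ 1` there are `L, c > 0` (`c ≤ 1/4`) such
that every Galois number field `N/ℚ` of degree `n` carries data `θ ∈ {0, 1}`, `β₁ ∈ (1 − c/(log|d_N| +
log 4), 1)` and a normal subgroup `K₁ ≤ G = Gal(N/ℚ)` — `θ = 0`, `K₁ = G` when `ζ_N` has no real zero in
that window; otherwise `θ = 1`, `ζ_N(β₁) = 0` and `K₁` is the index-two subgroup cutting out the quadratic
field in which `β₁` lives (`ζ_{N^H}(β₁) = 0 ↔ H ≤ K₁`, Heilbronn–Stark) — with the following property.  For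
EVERY conjugation-invariant set `S ⊆ G` and every `x ≥ |d_N|^L`, writing
`π_S(x) = #{p ≤ x : p ∤ d_N, Frob_p ∈ S}` and

  `M_S(x) = (|S| · Li(x) − θ · (|S ∩ K₁| − |S ∖ K₁|) · Li(x^{β₁})) / |G|`,

one has `|π_S(x) − M_S(x)| ≤ ε · M_S(x)` (`Li = offsetLogIntegral`).  This is
[LagariasMontgomeryOdlyzko1979, Theorem 1.1 / (1.4)] for an arbitrary union of conjugacy classes, with the
Siegel term made explicit through the real character `χ₁ = 𝟙_{K₁} − 𝟙_{G∖K₁}` carrying `β₁`: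
`Σ_{g ∈ S} χ₁(g) = |S ∩ K₁| − |S ∖ K₁|`.  Unconditional, inexplicit `L(n, ε)`.

Proof: split `S` into `S ∩ K₁` and `S ∖ K₁` (both conjugation-invariant, `K₁` being normal), decompose
each into conjugacy classes (`card_filter_subsetPred_eq_sum`, `sum_natCard_mk_eq`), apply
`frobeniusClass_PNT_pi_all` class by class — the sign is constant on each part since
`ζ_{N^{⟨σ⟩}}(β₁) = 0 ↔ σ ∈ K₁` — and add up the relative errors.
-/

noncomputable section

open scoped NumberField nonZeroDivisors
open Finset Real Ideal NumberField
open Literature.NumberTheory.NumberFields Literature.NumberTheory.LFunctions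
  Literature.NumberTheory.LFunctions.NumberField

namespace Summit.QuantumAdvantage.QuantumAdvantage.Theorems.DegreeOnePrimesEscape

variable {N : Type} [Field N] [NumberField N] [IsGalois ℚ N]

open scoped Classical in
/-- **Summation over the classes of a conjugation-invariant set.**  If every class `C(σ)`, `σ ∈ S`, obeys
`|π_{C(σ)}(x) − (|C(σ)|/|G|) m| ≤ ε (|C(σ)|/|G|) m`, then `|π_S(x) − (|S|/|G|) m| ≤ ε (|S|/|G|) m`. -/
theorem card_subsetPred_approx {S : Set (N ≃ₐ[ℚ] N)}
    (hS : ∀ g h : N ≃ₐ[ℚ] N, g ∈ S → h * g * h⁻¹ ∈ S) {x m ε : ℝ}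
    (h : ∀ σ ∈ S,
      |((((Nat.primesLE ⌊x⌋₊).filter
          (fun p : ℕ => ¬ ((p : ℤ) ∣ NumberField.discr N) ∧
            ∃ (Q : Ideal (𝓞 N)) (_ : Q.IsMaximal) (_ : Q.LiesOver (span {(p : ℤ)})) (φ g : N ≃ₐ[ℚ] N),
              IsArithFrobAt ℤ φ Q ∧ Q.inertia (N ≃ₐ[ℚ] N) = ⊥ ∧ g * φ * g⁻¹ = σ)).card : ℕ) : ℝ) -
        (Nat.card {τ : N ≃ₐ[ℚ] N // IsConj σ τ} : ℝ) / Nat.card (N ≃ₐ[ℚ] N) * m| ≤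
        ε * ((Nat.card {τ : N ≃ₐ[ℚ] N // IsConj σ τ} : ℝ) / Nat.card (N ≃ₐ[ℚ] N) * m)) :
    |((((Nat.primesLE ⌊x⌋₊).filter
        (fun p : ℕ => ¬ ((p : ℤ) ∣ NumberField.discr N) ∧
          ∃ (Q : Ideal (𝓞 N)) (_ : Q.IsMaximal) (_ : Q.LiesOver (span {(p : ℤ)})) (φ : N ≃ₐ[ℚ] N),
            IsArithFrobAt ℤ φ Q ∧ Q.inertia (N ≃ₐ[ℚ] N) = ⊥ ∧ φ ∈ S)).card : ℕ) : ℝ) -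
      (Nat.card S : ℝ) / Nat.card (N ≃ₐ[ℚ] N) * m| ≤
      ε * ((Nat.card S : ℝ) / Nat.card (N ≃ₐ[ℚ] N) * m) := by
  set R := (Finset.univ.filter fun g : N ≃ₐ[ℚ] N => g ∈ S).image ConjClasses.mk with hR
  have hrepex : ∀ C ∈ R, ∃ σ : N ≃ₐ[ℚ] N, σ ∈ S ∧ ConjClasses.mk σ = C := by
    intro C hC
    obtain ⟨s, hs, hsC⟩ := Finset.mem_image.mp hC
    exact ⟨s, (Finset.mem_filter.mp hs).2, hsC⟩
  choose! rep hrepS hrepC using hrepex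
  rw [card_filter_subsetPred_eq_sum hS rep hrepC ⌊x⌋₊]
  -- `|S| = Σ_C |C|`
  have hcardS : (Nat.card S : ℝ) = ∑ C ∈ R, (Nat.card {τ : N ≃ₐ[ℚ] N // IsConj (rep C) τ} : ℝ) := by
    rw [← sum_natCard_mk_eq hS]
    push_cast
    exact Finset.sum_congr rfl fun C hC => by rw [natCard_isConj_eq_natCard_mk_eq (hrepC C hC)]
  set piC : ConjClasses (N ≃ₐ[ℚ] N) → ℝ := fun C =>
    ((((Nat.primesLE ⌊x⌋₊).filter
      (fun p : ℕ => ¬ ((p : ℤ) ∣ NumberField.discr N) ∧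
        ∃ (Q : Ideal (𝓞 N)) (_ : Q.IsMaximal) (_ : Q.LiesOver (span {(p : ℤ)})) (φ g : N ≃ₐ[ℚ] N),
          IsArithFrobAt ℤ φ Q ∧ Q.inertia (N ≃ₐ[ℚ] N) = ⊥ ∧ g * φ * g⁻¹ = rep C)).card : ℕ) : ℝ)
    with hpiC
  set δ : ConjClasses (N ≃ₐ[ℚ] N) → ℝ := fun C =>
    (Nat.card {τ : N ≃ₐ[ℚ] N // IsConj (rep C) τ} : ℝ) / Nat.card (N ≃ₐ[ℚ] N) with hδ
  have hπC : ∀ C ∈ R, |piC C - δ C * m| ≤ ε * (δ C * m) := fun C hC => h (rep C) (hrepS C hC)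
  have hsumδ : (Nat.card S : ℝ) / Nat.card (N ≃ₐ[ℚ] N) * m = ∑ C ∈ R, δ C * m := by
    rw [hcardS, Finset.sum_div, Finset.sum_mul]
  have hcast : ((∑ C ∈ R, ((Nat.primesLE ⌊x⌋₊).filter
      (fun p : ℕ => ¬ ((p : ℤ) ∣ NumberField.discr N) ∧
        ∃ (Q : Ideal (𝓞 N)) (_ : Q.IsMaximal) (_ : Q.LiesOver (span {(p : ℤ)})) (φ g : N ≃ₐ[ℚ] N),
          IsArithFrobAt ℤ φ Q ∧ Q.inertia (N ≃ₐ[ℚ] N) = ⊥ ∧ g * φ * g⁻¹ = rep C)).card : ℕ) : ℝ) =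
      ∑ C ∈ R, piC C := by
    rw [hpiC]; push_cast; rfl
  rw [hcast, hsumδ, ← Finset.sum_sub_distrib]
  calc |∑ C ∈ R, (piC C - δ C * m)| ≤ ∑ C ∈ R, |piC C - δ C * m| := Finset.abs_sum_le_sum_abs _ _
    _ ≤ ∑ C ∈ R, ε * (δ C * m) := Finset.sum_le_sum hπC
    _ = ε * ∑ C ∈ R, δ C * m := by rw [Finset.mul_sum]

open scoped Classical in
/-- Splitting the count along a subgroup: `π_S = π_{S ∩ K} + π_{S ∖ K}`. -/
theorem card_subsetPred_split (S : Set (N ≃ₐ[ℚ] N)) (K : Subgroup (N ≃ₐ[ℚ] N)) [hK : K.Normal]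
    (s : Finset ℕ) (hs : ∀ p ∈ s, p.Prime) :
    (s.filter (fun p : ℕ => ¬ ((p : ℤ) ∣ NumberField.discr N) ∧
        ∃ (Q : Ideal (𝓞 N)) (_ : Q.IsMaximal) (_ : Q.LiesOver (span {(p : ℤ)})) (φ : N ≃ₐ[ℚ] N),
          IsArithFrobAt ℤ φ Q ∧ Q.inertia (N ≃ₐ[ℚ] N) = ⊥ ∧ φ ∈ S)).card =
      (s.filter (fun p : ℕ => ¬ ((p : ℤ) ∣ NumberField.discr N) ∧
        ∃ (Q : Ideal (𝓞 N)) (_ : Q.IsMaximal) (_ : Q.LiesOver (span {(p : ℤ)})) (φ : N ≃ₐ[ℚ] N),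
          IsArithFrobAt ℤ φ Q ∧ Q.inertia (N ≃ₐ[ℚ] N) = ⊥ ∧
            φ ∈ {g : N ≃ₐ[ℚ] N | g ∈ S ∧ g ∈ K})).card +
      (s.filter (fun p : ℕ => ¬ ((p : ℤ) ∣ NumberField.discr N) ∧
        ∃ (Q : Ideal (𝓞 N)) (_ : Q.IsMaximal) (_ : Q.LiesOver (span {(p : ℤ)})) (φ : N ≃ₐ[ℚ] N),
          IsArithFrobAt ℤ φ Q ∧ Q.inertia (N ≃ₐ[ℚ] N) = ⊥ ∧
            φ ∈ {g : N ≃ₐ[ℚ] N | g ∈ S ∧ g ∉ K})).card := by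
  -- a Frobenius class function: at `p ∤ d_N` all three predicates are read off one Frobenius `Φ p`
  have key : ∀ p : ℕ, p.Prime → ¬ ((p : ℤ) ∣ NumberField.discr N) → ∃ φ₀ : N ≃ₐ[ℚ] N,
      ∀ (Q : Ideal (𝓞 N)) (_ : Q.IsMaximal) (_ : Q.LiesOver (span {(p : ℤ)})) (φ : N ≃ₐ[ℚ] N),
        IsArithFrobAt ℤ φ Q → IsConj φ₀ φ := by
    intro p hp hpN
    obtain ⟨Q₀, hQ₀, hQ₀p, ⟨φ₀, hφ₀⟩, hI₀⟩ := exists_isArithFrobAt_of_not_dvd_discr (N := N) hp hpN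
    exact ⟨φ₀, fun Q hQ hQp φ hφ => isConj_of_isArithFrobAt hQ₀ hQ₀p hQ hQp hφ₀ hI₀ hφ⟩
  rw [← Finset.card_filter_add_card_filter_not (fun p : ℕ =>
    ∃ (Q : Ideal (𝓞 N)) (_ : Q.IsMaximal) (_ : Q.LiesOver (span {(p : ℤ)})) (φ : N ≃ₐ[ℚ] N),
      IsArithFrobAt ℤ φ Q ∧ Q.inertia (N ≃ₐ[ℚ] N) = ⊥ ∧ φ ∈ {g : N ≃ₐ[ℚ] N | g ∈ S ∧ g ∈ K})]
  rw [Finset.filter_filter, Finset.filter_filter]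
  congr 1
  · congr 1
    refine Finset.filter_congr fun p hp => ?_
    constructor
    · rintro ⟨⟨hpN, -⟩, h2⟩; exact ⟨hpN, h2⟩
    · rintro ⟨hpN, Q, hQ, hQp, φ, hφ, hI, hφS⟩
      exact ⟨⟨hpN, Q, hQ, hQp, φ, hφ, hI, hφS.1⟩, Q, hQ, hQp, φ, hφ, hI, hφS⟩
  · congr 1
    refine Finset.filter_congr fun p hp => ?_
    constructor
    · rintro ⟨⟨hpN, Q, hQ, hQp, φ, hφ, hI, hφS⟩, h2⟩
      refine ⟨hpN, Q, hQ, hQp, φ, hφ, hI, hφS, fun hφK => h2 ⟨Q, hQ, hQp, φ, hφ, hI, hφS, hφK⟩⟩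
    · rintro ⟨hpN, Q, hQ, hQp, φ, hφ, hI, hφS⟩
      refine ⟨⟨hpN, Q, hQ, hQp, φ, hφ, hI, hφS.1⟩, ?_⟩
      rintro ⟨Q', hQ', hQ'p, φ', hφ', -, hφ'S⟩
      obtain ⟨φ₀, hφ₀⟩ := key p (hs p hp) hpN
      have h1 : IsConj φ φ' :=
        (hφ₀ Q hQ hQp φ hφ).symm.trans (hφ₀ Q' hQ' hQ'p φ' hφ')
      obtain ⟨c, hc⟩ := isConj_iff.mp h1
      apply hφS.2
      have h2 := hK.conj_mem φ' hφ'S.2 c⁻¹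
      have h3 : c⁻¹ * φ' * c⁻¹⁻¹ = φ := by rw [← hc]; group
      rwa [h3] at h2

open scoped Classical in
/-- `|S| = |S ∩ K| + |S ∖ K|` for a subset `S` and a subgroup `K` of a finite group. -/
theorem natCard_set_eq_add {G : Type*} [Group G] [Fintype G] (S : Set G) (K : Subgroup G) :
    Nat.card S = Nat.card {g : G // g ∈ S ∧ g ∈ K} + Nat.card {g : G // g ∈ S ∧ g ∉ K} := by
  have h1 : Nat.card S = (Finset.univ.filter fun g : G => g ∈ S).card := by
    rw [Nat.card_eq_fintype_card, ← Fintype.card_subtype]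
  have h2 : Nat.card {g : G // g ∈ S ∧ g ∈ K} =
      ((Finset.univ.filter fun g : G => g ∈ S).filter fun g : G => g ∈ K).card := by
    rw [Nat.card_eq_fintype_card, Fintype.card_subtype, Finset.filter_filter]
  have h3 : Nat.card {g : G // g ∈ S ∧ g ∉ K} =
      ((Finset.univ.filter fun g : G => g ∈ S).filter fun g : G => ¬ g ∈ K).card := by
    rw [Nat.card_eq_fintype_card, Fintype.card_subtype, Finset.filter_filter]
  rw [h1, h2, h3, Finset.card_filter_add_card_filter_not]

/-- Adding two relative-error estimates. -/
theorem abs_add_sub_add_le_of_rel {a b A B ε : ℝ} (h1 : |a - A| ≤ ε * A) (h2 : |b - B| ≤ ε * B) :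
    |a + b - (A + B)| ≤ ε * (A + B) := by
  calc |a + b - (A + B)| = |(a - A) + (b - B)| := by ring_nf
    _ ≤ |a - A| + |b - B| := abs_add_le _ _
    _ ≤ ε * A + ε * B := add_le_add h1 h2
    _ = ε * (A + B) := by ring

set_option maxHeartbeats 4000000 in
open scoped Classical in
/-- **The Chebotarev prime number theorem in the Linnik range for a conjugation-invariant set** (see the
module docstring): for `n > 1`, `0 < ε ≤ 1` there are `L, c > 0`, `c ≤ 1/4`, such that every Galois `N` of
degree `n` has data `θ ∈ {0,1}`, `β₁ ∈ (1 − c/(log|d_N| + log 4), 1)`, `K₁ ⊴ Gal(N/ℚ)` (`θ = 1`: `ζ_N(β₁) = 0`,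
`[G : K₁] = 2`, `ζ_{N^H}(β₁) = 0 ↔ H ≤ K₁`; `θ = 0`: `K₁ = G` and no real zero in the window) such that for
every conjugation-invariant `S ⊆ Gal(N/ℚ)` and every `x ≥ |d_N|^L`,
`|π_S(x) − M_S(x)| ≤ ε M_S(x)` with `π_S(x) = #{p ≤ x : p ∤ d_N, Frob_p ∈ S}` and
`M_S(x) = (|S| Li(x) − θ (|S ∩ K₁| − |S ∖ K₁|) Li(x^{β₁}))/|G|`.  Unconditional.
[cite: LagariasMontgomeryOdlyzko1979, Theorem 1.1] [cite: ThornerZaman2019, Theorem 1.4] -/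
theorem conjInvariant_PNT_pi (n : ℕ) (hn : 1 < n) {ε : ℝ} (hε : 0 < ε) (hε1 : ε ≤ 1) :
    ∃ L c : ℝ, 0 < L ∧ 0 < c ∧ c ≤ 1 / 4 ∧ ∀ (N : Type) [Field N] [NumberField N] [IsGalois ℚ N],
      Module.finrank ℚ N = n →
      ∃ (θ β₁ : ℝ) (K₁ : Subgroup (N ≃ₐ[ℚ] N)), (θ = 0 ∨ θ = 1) ∧ K₁.Normal ∧
        1 - c / (Real.log ((NumberField.discr N).natAbs : ℝ) + Real.log 4) < β₁ ∧ β₁ < 1 ∧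
        (θ = 1 → dedekindZeta₁ N β₁ = 0 ∧ K₁.index = 2 ∧
          ∀ H : Subgroup (N ≃ₐ[ℚ] N),
            dedekindZeta₁ (IntermediateField.fixedField H) β₁ = 0 ↔ H ≤ K₁) ∧
        (θ = 0 → K₁ = ⊤ ∧ ¬ ∃ β : ℝ, dedekindZeta₁ N β = 0 ∧
          1 - c / (Real.log ((NumberField.discr N).natAbs : ℝ) + Real.log 4) < β ∧ β < 1) ∧
        ∀ S : Set (N ≃ₐ[ℚ] N), (∀ g h : N ≃ₐ[ℚ] N, g ∈ S → h * g * h⁻¹ ∈ S) →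
          ∀ x : ℝ, ((NumberField.discr N).natAbs : ℝ) ^ L ≤ x →
            |((((Nat.primesLE ⌊x⌋₊).filter
                (fun p : ℕ => ¬ ((p : ℤ) ∣ NumberField.discr N) ∧
                  ∃ (Q : Ideal (𝓞 N)) (_ : Q.IsMaximal) (_ : Q.LiesOver (span {(p : ℤ)})) (φ : N ≃ₐ[ℚ] N),
                    IsArithFrobAt ℤ φ Q ∧ Q.inertia (N ≃ₐ[ℚ] N) = ⊥ ∧ φ ∈ S)).card : ℕ) : ℝ) -
              ((Nat.card S : ℝ) * offsetLogIntegral x -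
                θ * ((Nat.card {g : N ≃ₐ[ℚ] N // g ∈ S ∧ g ∈ K₁} : ℝ) -
                  Nat.card {g : N ≃ₐ[ℚ] N // g ∈ S ∧ g ∉ K₁}) * offsetLogIntegral (x ^ β₁)) /
                Nat.card (N ≃ₐ[ℚ] N)| ≤
              ε * (((Nat.card S : ℝ) * offsetLogIntegral x -
                θ * ((Nat.card {g : N ≃ₐ[ℚ] N // g ∈ S ∧ g ∈ K₁} : ℝ) -
                  Nat.card {g : N ≃ₐ[ℚ] N // g ∈ S ∧ g ∉ K₁}) * offsetLogIntegral (x ^ β₁)) /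
                Nat.card (N ≃ₐ[ℚ] N)) := by
  obtain ⟨L, c, hL, hc, hc4, h⟩ := frobeniusClass_PNT_pi_all n hn hε hε1
  refine ⟨L, c, hL, hc, hc4, fun N _ _ _ hN => ?_⟩
  have hN1 : 1 < Module.finrank ℚ N := by rw [hN]; exact hn
  have hd3 : (3 : ℝ) ≤ ((NumberField.discr N).natAbs : ℝ) := three_le_natAbs_discr_real N hN1
  have hℓ : 0 < Real.log ((NumberField.discr N).natAbs : ℝ) + Real.log 4 := by
    have := Real.log_pos (by linarith : (1 : ℝ) < ((NumberField.discr N).natAbs : ℝ))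
    have := Real.log_pos (by norm_num : (1 : ℝ) < 4)
    linarith
  by_cases hexc : ∃ β₁ : ℝ, dedekindZeta₁ N β₁ = 0 ∧
      1 - c / (Real.log ((NumberField.discr N).natAbs : ℝ) + Real.log 4) < β₁ ∧ β₁ < 1
  · -- the exceptional case: `θ = 1`, `K₁` from Heilbronn–Stark
    obtain ⟨β₁, hζ₁, hβ₁c, hβ₁1⟩ := hexc
    obtain ⟨K₁, hK₁, hiff⟩ := exists_index_two_of_exceptional hN1 hc4 hζ₁ hβ₁c hβ₁1
    haveI hK₁n : K₁.Normal := Subgroup.normal_of_index_eq_two hK₁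
    refine ⟨1, β₁, K₁, Or.inr rfl, hK₁n, hβ₁c, hβ₁1, fun _ => ⟨hζ₁, hK₁, hiff⟩,
      fun h0 => absurd h0 one_ne_zero, fun S hS x hx => ?_⟩
    have hzeta_iff : ∀ σ : N ≃ₐ[ℚ] N,
        dedekindZeta₁ (IntermediateField.fixedField (Subgroup.zpowers σ)) β₁ = 0 ↔ σ ∈ K₁ := by
      intro σ; rw [hiff, Subgroup.zpowers_le]
    -- the part inside `K₁`: sign `−`
    have hP : |((((Nat.primesLE ⌊x⌋₊).filter
        (fun p : ℕ => ¬ ((p : ℤ) ∣ NumberField.discr N) ∧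
          ∃ (Q : Ideal (𝓞 N)) (_ : Q.IsMaximal) (_ : Q.LiesOver (span {(p : ℤ)})) (φ : N ≃ₐ[ℚ] N),
            IsArithFrobAt ℤ φ Q ∧ Q.inertia (N ≃ₐ[ℚ] N) = ⊥ ∧
              φ ∈ {g : N ≃ₐ[ℚ] N | g ∈ S ∧ g ∈ K₁})).card : ℕ) : ℝ) -
        (Nat.card {g : N ≃ₐ[ℚ] N // g ∈ S ∧ g ∈ K₁} : ℝ) / Nat.card (N ≃ₐ[ℚ] N) *
          (offsetLogIntegral x - offsetLogIntegral (x ^ β₁))| ≤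
        ε * ((Nat.card {g : N ≃ₐ[ℚ] N // g ∈ S ∧ g ∈ K₁} : ℝ) / Nat.card (N ≃ₐ[ℚ] N) *
          (offsetLogIntegral x - offsetLogIntegral (x ^ β₁))) :=
      card_subsetPred_approx (conjInvariant_inter_of_normal hS K₁)
        (m := offsetLogIntegral x - offsetLogIntegral (x ^ β₁))
        (fun σ hσ => ((h N hN σ).2 β₁ hζ₁ hβ₁c hβ₁1).1 ((hzeta_iff σ).mpr hσ.2) x hx)
    -- the part outside `K₁`: sign `+`
    have hM : |((((Nat.primesLE ⌊x⌋₊).filter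
        (fun p : ℕ => ¬ ((p : ℤ) ∣ NumberField.discr N) ∧
          ∃ (Q : Ideal (𝓞 N)) (_ : Q.IsMaximal) (_ : Q.LiesOver (span {(p : ℤ)})) (φ : N ≃ₐ[ℚ] N),
            IsArithFrobAt ℤ φ Q ∧ Q.inertia (N ≃ₐ[ℚ] N) = ⊥ ∧
              φ ∈ {g : N ≃ₐ[ℚ] N | g ∈ S ∧ g ∉ K₁})).card : ℕ) : ℝ) -
        (Nat.card {g : N ≃ₐ[ℚ] N // g ∈ S ∧ g ∉ K₁} : ℝ) / Nat.card (N ≃ₐ[ℚ] N) *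
          (offsetLogIntegral x + offsetLogIntegral (x ^ β₁))| ≤
        ε * ((Nat.card {g : N ≃ₐ[ℚ] N // g ∈ S ∧ g ∉ K₁} : ℝ) / Nat.card (N ≃ₐ[ℚ] N) *
          (offsetLogIntegral x + offsetLogIntegral (x ^ β₁))) :=
      card_subsetPred_approx (conjInvariant_diff_of_normal hS K₁)
        (m := offsetLogIntegral x + offsetLogIntegral (x ^ β₁))
        (fun σ hσ => ((h N hN σ).2 β₁ hζ₁ hβ₁c hβ₁1).2 (fun h0 => hσ.2 ((hzeta_iff σ).mp h0)) x hx)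
    have hsplit := card_subsetPred_split S K₁ (Nat.primesLE ⌊x⌋₊)
      (fun p hp => (Nat.mem_primesLE.mp hp).2)
    have hcs : (Nat.card S : ℝ) = (Nat.card {g : N ≃ₐ[ℚ] N // g ∈ S ∧ g ∈ K₁} : ℝ) +
        Nat.card {g : N ≃ₐ[ℚ] N // g ∈ S ∧ g ∉ K₁} := by
      exact_mod_cast natCard_set_eq_add S K₁
    have key := abs_add_sub_add_le_of_rel hP hM
    have e : ((Nat.card S : ℝ) * offsetLogIntegral x -
        1 * ((Nat.card {g : N ≃ₐ[ℚ] N // g ∈ S ∧ g ∈ K₁} : ℝ) -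
          Nat.card {g : N ≃ₐ[ℚ] N // g ∈ S ∧ g ∉ K₁}) * offsetLogIntegral (x ^ β₁)) /
        Nat.card (N ≃ₐ[ℚ] N) =
        (Nat.card {g : N ≃ₐ[ℚ] N // g ∈ S ∧ g ∈ K₁} : ℝ) / Nat.card (N ≃ₐ[ℚ] N) *
          (offsetLogIntegral x - offsetLogIntegral (x ^ β₁)) +
        (Nat.card {g : N ≃ₐ[ℚ] N // g ∈ S ∧ g ∉ K₁} : ℝ) / Nat.card (N ≃ₐ[ℚ] N) *
          (offsetLogIntegral x + offsetLogIntegral (x ^ β₁)) := by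
      rw [hcs]; ring
    rw [e, hsplit, Nat.cast_add]
    exact key
  · -- no exceptional zero: `θ = 0`, `K₁ = G`
    refine ⟨0, 1 - c / (2 * (Real.log ((NumberField.discr N).natAbs : ℝ) + Real.log 4)), ⊤, Or.inl rfl,
      inferInstance, ?_, ?_, fun h1 => absurd h1.symm one_ne_zero, fun _ => ⟨rfl, hexc⟩,
      fun S hS x hx => ?_⟩
    · have : c / (2 * (Real.log ((NumberField.discr N).natAbs : ℝ) + Real.log 4)) <
          c / (Real.log ((NumberField.discr N).natAbs : ℝ) + Real.log 4) := by
        rw [div_lt_div_iff_of_pos_left hc (by positivity) hℓ]; linarith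
      linarith
    · have : 0 < c / (2 * (Real.log ((NumberField.discr N).natAbs : ℝ) + Real.log 4)) := by positivity
      linarith
    have hA := card_subsetPred_approx hS (m := offsetLogIntegral x) (fun σ hσ => (h N hN σ).1 hexc x hx)
    have e : ((Nat.card S : ℝ) * offsetLogIntegral x -
        0 * ((Nat.card {g : N ≃ₐ[ℚ] N // g ∈ S ∧ g ∈ (⊤ : Subgroup (N ≃ₐ[ℚ] N))} : ℝ) -
          Nat.card {g : N ≃ₐ[ℚ] N // g ∈ S ∧ g ∉ (⊤ : Subgroup (N ≃ₐ[ℚ] N))}) *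
          offsetLogIntegral (x ^ (1 - c / (2 * (Real.log ((NumberField.discr N).natAbs : ℝ) +
            Real.log 4))))) / Nat.card (N ≃ₐ[ℚ] N) =
        (Nat.card S : ℝ) / Nat.card (N ≃ₐ[ℚ] N) * offsetLogIntegral x := by ring
    rw [e]
    exact hA

end Summit.QuantumAdvantage.QuantumAdvantage.Theorems.DegreeOnePrimesEscape

end
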